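import Summits.QuantumAdvantage.QuantumAdvantage.Theorems.LengthDialD

/-!
# LengthDial, part E/7 (§9–§10: the degree-0 slice DECIDED for all primes (`degZeroHard`, finite range `{2,3}` by `decide` + `reach`) and the `p = 2` two-lengths criterion (`eventuallyHard_charTwo_iff`)) — support for item stmt-QuantumAdvantage-28401 (`Theses.AbsorptionDial.MassHiQuasi`)

Cell decomp-qadv, seat lens-5 («finite range + asymptotic regime + bridge»), generation 26 — land port of the node
«LengthDial» (published under the cell's HOME/decomp-qadv-lens-5/g26/LengthDial.lean, record NODE-g26.md; RESIDUAL MODE on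
AbsorptionDial:28401 `MassHiQuasi`).  The node file with ONLY the namespace renamed `Theses.LengthDial → Theorems.LengthDial`
and split at section boundaries into parts A–G (each importing the previous; part G alone imports the route file
Theses.AbsorptionDial for the BY-NAME equivalences and `closes`).  Prop-defs = the node's hardness predicates / grades only.
Tree facts reused by name, not restated: `RigidityLaws.walkExp_zero/self`, `RigidityLaws.ringWinU_congr_mod`,
`RigidityLaws.threeCharge`, `RigidityLaws.hasDegF_xor`, `FibreDial.const_of_hasDegF_zero`, `WalkCoreBasics.ringWinU_compl`, `chargeRecursion`, `sliceAt_mem_lowDeg`,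
`Smolensky.comp_mem_lowDeg_of_coord`.  No `sorry`, no new axioms, no instances, no notation.
-/

set_option autoImplicit false
set_option linter.unusedVariables false
set_option linter.dupNamespace false
set_option linter.style.longLine false

namespace Summit.QuantumAdvantage.QuantumAdvantage.Theorems.LengthDial

open Finset
open Summit.QuantumAdvantage.AdviceFreeQNC0
open Literature.Computability.MetaComplexity Literature.Computability.MetaComplexity.Smolensky

/-! ## §9 The degree-0 slice, DECIDED by finite range `{2, 3}` + the law (all primes `p`) -/

section DegreeZero
variable {p : ℕ} [Fact p.Prime] {m n : ℕ}

/-- the oblivious strategy `S ⊆ cuts`: win iff an odd number of chosen cuts is counted. -/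
def oblWin (c : ℕ) (S : Finset (Fin (m + 1))) (u : Fin m → Bool) : Bool :=
  decide ((S.filter fun g => (c + g.val + walkExp u g.val) % 3 ≠ 0).card % 2 = 1)

/-- its win count. -/
def oblCount (m c : ℕ) (S : Finset (Fin (m + 1))) : ℕ :=
  (univ.filter fun u : Fin m → Bool => oblWin c S u = true).card

/-- a degree-`0` (input-oblivious) strategy wins exactly on `oblWin` of its cut set. -/
theorem ringWinU_of_oblivious (c : ℕ) (y : Fin (m + 1) → (Fin m → Bool) → Bool)
    (hy : ∀ g u v, y g u = y g v) (u : Fin m → Bool) :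
    ringWinU c y u = oblWin c (univ.filter fun g => y g (fun _ => false) = true) u := by
  unfold ringWinU oblWin
  apply Bool.decide_congr
  rw [Finset.filter_filter]
  have key : ∀ g, y g u = y g (fun _ => false) := fun g => hy g u _
  simp_rw [key]

/-- win count of an oblivious strategy = `oblCount` of its cut set. -/
theorem winCount_of_oblivious (c : ℕ) (y : Fin (m + 1) → (Fin m → Bool) → Bool)
    (hy : ∀ g u v, y g u = y g v) :
    winCount m c y = oblCount m c (univ.filter fun g => y g (fun _ => false) = true) := by
  unfold winCount oblCount
  simp_rw [ringWinU_of_oblivious c y hy]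

/-- `oblWin` only depends on the charge mod `3`. -/
theorem oblWin_charge_mod {c c' : ℕ} (h : c % 3 = c' % 3) (S : Finset (Fin (m + 1))) (u : Fin m → Bool) :
    oblWin c S u = oblWin c' S u := by
  unfold oblWin
  apply Bool.decide_congr
  have hf : (S.filter fun g => (c + g.val + walkExp u g.val) % 3 ≠ 0)
      = S.filter fun g => (c' + g.val + walkExp u g.val) % 3 ≠ 0 :=
    Finset.filter_congr fun g _ => by omega
  rw [hf]

/-- `oblCount` only depends on the charge mod `3`. -/
theorem oblCount_charge_mod {c c' : ℕ} (h : c % 3 = c' % 3) (S : Finset (Fin (m + 1))) :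
    oblCount m c S = oblCount m c' S := by
  unfold oblCount
  simp_rw [oblWin_charge_mod h]

/-- value bound for ALL oblivious strategies at `(m, c)`. -/
def OblBound (m c K : ℕ) : Prop := ∀ S : Finset (Fin (m + 1)), oblCount m c S ≤ K

/-! #### the finite range: lengths `2` and `3`, off-diagonal charges (kernel `decide`) -/

/-- length `2`, charge `0`: every oblivious strategy wins at most `3` of `4` inputs (`decide`). -/
theorem oblBound_2_0 : OblBound 2 0 3 := by unfold OblBound oblCount oblWin; decide
/-- length `2`, charge `1`: every oblivious strategy wins at most `3` of `4` inputs (`decide`). -/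
theorem oblBound_2_1 : OblBound 2 1 3 := by unfold OblBound oblCount oblWin; decide
/-- length `3`, charge `1`: every oblivious strategy wins at most `6` of `8` inputs (`decide`). -/
theorem oblBound_3_1 : OblBound 3 1 6 := by unfold OblBound oblCount oblWin; decide
/-- length `3`, charge `2`: every oblivious strategy wins at most `6` of `8` inputs (`decide`). -/
theorem oblBound_3_2 : OblBound 3 2 6 := by unfold OblBound oblCount oblWin; decide

/-- a finite `OblBound` certificate at charge `c % 3` is degree-`0` hardness at charge `c`. -/
theorem hardR_zero_of_oblBound {c K : ℕ} {θ : ℝ} (hK : OblBound m (c % 3) K) (hθ : (K : ℝ) ≤ θ * 2 ^ m)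
    (y : Fin (m + 1) → (Fin m → Bool) → Bool) (hy : ∀ g, HasDegF p (y g) 0) :
    (winCount m c y : ℝ) ≤ θ * 2 ^ m := by
  have hob : ∀ g u v, y g u = y g v := fun g => Theorems.FibreDial.const_of_hasDegF_zero (hy g)
  rw [winCount_of_oblivious c y hob, oblCount_charge_mod (show c % 3 = (c % 3) % 3 by omega)]
  exact le_trans (by exact_mod_cast hK _) hθ

/-- **length 2, degree 0, off-diagonal: value `≤ 3/4`** (decided). -/
theorem offHardR_zero_two : OffHardR p 2 0 (3 / 4) := by
  intro c hc y hy
  unfold OffDiag at hc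
  have h3 : c % 3 = 0 ∨ c % 3 = 1 := by omega
  rcases h3 with h | h
  · exact hardR_zero_of_oblBound (by rw [h]; exact oblBound_2_0) (by norm_num) y hy
  · exact hardR_zero_of_oblBound (by rw [h]; exact oblBound_2_1) (by norm_num) y hy

/-- **length 3, degree 0, off-diagonal: value `≤ 3/4`** (decided). -/
theorem offHardR_zero_three : OffHardR p 3 0 (3 / 4) := by
  intro c hc y hy
  unfold OffDiag at hc
  have h3 : c % 3 = 1 ∨ c % 3 = 2 := by omega
  rcases h3 with h | h
  · exact hardR_zero_of_oblBound (by rw [h]; exact oblBound_3_1) (by norm_num) y hy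
  · exact hardR_zero_of_oblBound (by rw [h]; exact oblBound_3_2) (by norm_num) y hy

/-- **THE DEGREE-0 SLICE, DECIDED FOR EVERY PRIME `p` AND EVERY LENGTH `n ≥ 4`** — finite range `{2,3}`
(kernel `decide`) + the length law (`reach`, lossless at `D = 0`) ⟹ the whole asymptotic regime: every
oblivious strategy wins on at most `3/4 · 2ⁿ` inputs, at every charge.  (The lens triad realised once,
exactly, in the kernel; the true limit value is `2/3`.) -/
theorem degZeroHard (n : ℕ) (hn : 4 ≤ n) : HardR p n 0 (3 / 4) := by
  have hm : OffHardR p 2 (5 ^ (n - 3) * 0) (3 / 4) := by simpa using (offHardR_zero_two (p := p))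
  have hm1 : OffHardR p (2 + 1) (5 ^ (n - 3) * 0) (3 / 4) := by simpa using (offHardR_zero_three (p := p))
  have h := reach hm hm1 (n - 4) (by omega)
  rw [Nat.mul_zero, show 2 + 2 + (n - 4) = n by omega] at h
  exact h

end DegreeZero


/-! ## §10 `p = 2`: every fixed 𝔽₂-degree is an XOR-closed class — two lengths decide all lengths -/

section CharTwo
variable {n : ℕ}

/-- over `𝔽₂` XOR is free: `[f ⊕ g] = F + G`. -/
theorem hasDegF_two_xor {D : ℕ} {f g : (Fin n → Bool) → Bool} (hf : HasDegF 2 f D) (hg : HasDegF 2 g D) :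
    HasDegF 2 (fun u => xor (f u) (g u)) D := by
  unfold HasDegF at *
  have h : (fun x : Fin n → Bool => if xor (f x) (g x) = true then (1 : ZMod 2) else 0)
      = (fun x => if f x = true then (1 : ZMod 2) else 0) + (fun x => if g x = true then (1 : ZMod 2) else 0) := by
    funext x
    simp only [Pi.add_apply]
    have key : ∀ a b : Bool, (if xor a b = true then (1 : ZMod 2) else 0)
        = (if a = true then 1 else 0) + (if b = true then 1 else 0) := by decide
    exact key (f x) (g x)
  rw [h]
  exact Submodule.add_mem _ hf hg

/-- the class of 𝔽₂-degree-`≤ D` cut functions (restriction-closed, XOR-closed, contains `false`). -/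
def degTwoClass (D : ℕ) : CutClass where
  mem f := HasDegF 2 f D
  cons_mem b f hf := hasDegF_cons b hf
  xor_mem f g hf hg := hasDegF_two_xor hf hg
  false_mem := hasDegF_falseFn D

/-- **`p = 2`, FIXED DEGREE: TWO CONSECUTIVE LENGTHS DECIDE EVERY LATER LENGTH, WITHOUT LOSS.**
Off-diagonal hardness of the 𝔽₂-degree-`D` game at lengths `m, m+1` with value bound `θ` gives hardness `θ`
at EVERY length `n ≥ m + 2`, same degree, every charge.  (So "`∃ n₀, ∀ n ≥ n₀, HardR 2 n D θ`" is
equivalent to the FINITE certificate "`∃ m, OffHardR 2 m D θ ∧ OffHardR 2 (m+1) D θ`".) -/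
theorem twoLengths_charTwo {m D : ℕ} {θ : ℝ} (hm : OffHardR 2 m D θ) (hm1 : OffHardR 2 (m + 1) D θ) :
    ∀ n, m + 2 ≤ n → HardR 2 n D θ := by
  have h := (degTwoClass D).twoLengths (m := m) (θ := θ)
    (fun c hc y hy => hm c hc y hy) (fun c hc y hy => hm1 c hc y hy)
  intro n hn c y hy
  exact h n hn c y hy

/-- the finite-certificate form, `p = 2`. -/
theorem eventuallyHard_charTwo_iff (D : ℕ) (θ : ℝ) :
    (∃ n₀, ∀ n, n₀ ≤ n → HardR 2 n D θ) ↔ ∃ m, OffHardR 2 m D θ ∧ OffHardR 2 (m + 1) D θ := by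
  constructor
  · rintro ⟨n₀, h⟩
    exact ⟨n₀, offHardR_of_hardR (h n₀ le_rfl), offHardR_of_hardR (h (n₀ + 1) (by omega))⟩
  · rintro ⟨m, hm, hm1⟩
    exact ⟨m + 2, fun n hn => twoLengths_charTwo hm hm1 n hn⟩

end CharTwo

end Summit.QuantumAdvantage.QuantumAdvantage.Theorems.LengthDial
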